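import Summits.AtomisticToContinuum.Crystallization.Theorems.GappedShellCensusCleanLimitsHaveWindowsLayerCakeBand1

/-!
# `CleanLimitsHaveWindows` (stmt-AtomisticToContinuum-15932), line `Sketch`, helper for stub `stub_layerCakeBand`:
# the layer cake on the clean band, part 2 (the site energy layer by layer; far indices are far points)

Support file for the crux `GappedShellCensus.CleanLimitsHaveWindows`, continuing part 1
(`…CleanLimitsHaveWindowsLayerCakeBand1`): the band versions (`a ≥ 9/10`, any word, increments of the heights
`≥ 7a/10`, no upper bounds) of

* `LayeredHull.cake_siteEnergy` — the site energy of the point `p₀ = A (i u + j v + L(m) w + z(m) e₃)` of `S(A, s, z)`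
  is `Φ₀(a) + ∑'_{m' ≠ m} layerInteraction V_LJ a (z m' − z m) (L m' − L m) 1` (`cakeB_siteEnergy`): the same
  regrouping by layers of the absolutely convergent sum, fed with the band estimates of part 1;
* `LayeredHull.cake_dist_recentred_ge` — two re-centred layered points whose layer indices, or one of whose in-plane
  index differences, differ by `≥ d + 1` are `≥ (d - 1)/4` apart (`cakeB_dist_recentred_ge`; the coordinate-wise
  triangle inequalities of the original with the constants `a/2 ≥ 9/20`, `a√3/6 ≥ 153/600`, `7a/10 ≥ 63/100`).
-/

namespace Summit.AtomisticToContinuum.Crystallization.Theorems.CleanHull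

open Literature.MathematicalPhysics.StatisticalMechanics
open Summit.AtomisticToContinuum.Crystallization.Theorems.LayeredHull

/-! ## The site energy -/

/-- **The site energy of a layered set on the band, layer by layer.** For `a ≥ 9/10`, a linear isometry `A`, any
word `s` and heights with increments `≥ 7a/10`, the site energy of the point `p₀ = A (i u + j v + L(m) w + z(m) e₃)` in
`S(A, s, z)` is `Φ₀(a) + ∑'_{m'} (if m' = m then 0 else layerInteraction V_LJ a (z m' − z m) (L m' − L m) 1)`.
[folklore] -/
theorem cakeB_siteEnergy (a : ℝ) (ha : 9 / 10 ≤ a) (A : (EuclideanSpace ℝ (Fin 3)) →ₗᵢ[ℝ]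
    (EuclideanSpace ℝ (Fin 3))) (s : ℤ → ℤ)
    (z : ℤ → ℝ) (hz : ∀ m : ℤ, 7 / 10 * a ≤ z (m + 1) - z m) (m i j : ℤ) :
    (∑' q : {q : (EuclideanSpace ℝ (Fin 3)) // q ∈ {p : (EuclideanSpace ℝ (Fin 3)) | ∃ m i j : ℤ, p = A (((i : ℝ)
        • triangularVec₁ a) +
        ((j : ℝ) • triangularVec₂ a) + ((haggLabel s m : ℝ) • barlowOffset a) + (z m • layerNormal 1))} ∧
        q ≠ A (((i : ℝ) • triangularVec₁ a) + ((j : ℝ) • triangularVec₂ a) +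
          ((haggLabel s m : ℝ) • barlowOffset a) + (z m • layerNormal 1))},
      lennardJones (dist (A (((i : ℝ) • triangularVec₁ a) + ((j : ℝ) • triangularVec₂ a) +
        ((haggLabel s m : ℝ) • barlowOffset a) + (z m • layerNormal 1))) (q : (EuclideanSpace ℝ (Fin 3))))) =
    inLayerInteraction lennardJones a + ∑' m' : ℤ, if m' = m then (0 : ℝ) else
      layerInteraction lennardJones a (z m' - z m) (haggLabel s m' - haggLabel s m) 1 := by
  have ha0 : 0 < a := by linarith
  -- the parametrisation
  set e : ℤ × ℤ × ℤ → (EuclideanSpace ℝ (Fin 3)) := fun t => A (layerVec a (z t.1) (haggLabel s t.1) 1 t.2.1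
      t.2.2) with he
  have hpt : ∀ m i j : ℤ, A (((i : ℝ) • triangularVec₁ a) + ((j : ℝ) • triangularVec₂ a) +
      ((haggLabel s m : ℝ) • barlowOffset a) + (z m • layerNormal 1)) = e (m, i, j) := by
    intro m i j
    simp only [he, cake_pt_eq_layerVec]
  have hS : {p : (EuclideanSpace ℝ (Fin 3)) | ∃ m i j : ℤ, p = A (((i : ℝ) • triangularVec₁ a) + ((j : ℝ) •
      triangularVec₂ a) +
      ((haggLabel s m : ℝ) • barlowOffset a) + (z m • layerNormal 1))} = Set.range e := by
    ext p
    simp only [Set.mem_setOf_eq, Set.mem_range, hpt]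
    constructor
    · rintro ⟨m, i, j, rfl⟩; exact ⟨(m, i, j), rfl⟩
    · rintro ⟨⟨m, i, j⟩, rfl⟩; exact ⟨m, i, j, rfl⟩
  have hzinj : Function.Injective z := cakeB_height_injective a ha0 z hz
  have hinj : Function.Injective e := by
    rintro ⟨m₁, i₁, j₁⟩ ⟨m₂, i₂, j₂⟩ h
    obtain ⟨rfl, rfl, rfl⟩ := cake_param_injective a ha0.ne' (haggLabel s) z hzinj (A.injective h)
    rfl
  -- the family on `ℤ × ℤ × ℤ` and its slices
  set F : ℤ × ℤ × ℤ → ℝ := fun t => lennardJones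
    ‖layerVec a (z t.1 - z m) (haggLabel s t.1 - haggLabel s m) 1 (t.2.1 - i) (t.2.2 - j)‖ with hF
  set g : ℤ → ℤ × ℤ → ℝ := fun m' ij =>
    lennardJones ‖layerVec a (z m' - z m) (haggLabel s m' - haggLabel s m) 1 ij.1 ij.2‖ with hg
  have hfe : ∀ t, lennardJones (dist (e (m, i, j)) (e t)) = F t := by
    intro t
    rw [he, LinearIsometry.dist_map, dist_comm, dist_eq_norm, cake_layerVec_sub]
  have hFg : ∀ (m' : ℤ) (ij : ℤ × ℤ), F (m', ij) = g m' (Equiv.subRight ((i, j) : ℤ × ℤ) ij) :=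
    fun _ _ => rfl
  have hslice : ∀ m' : ℤ, Summable (fun ij : ℤ × ℤ => |g m' ij|) ∧
      (m' ≠ m → ∑' ij : ℤ × ℤ, |g m' ij| ≤ 480 / (z m' - z m) ^ 4) := by
    intro m'
    by_cases hm : m' = m
    · refine ⟨?_, fun h => absurd hm h⟩
      have h0 : g m' = fun ij : ℤ × ℤ => lennardJones ‖layerVec a 0 0 1 ij.1 ij.2‖ := by
        funext ij
        simp only [hg, hm, sub_self]
      rw [h0]
      exact cakeB_summable_abs_inLayer a ha
    · have hH := cakeB_height_sep' a ha z hz hm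
      exact ⟨(cakeB_summable_abs_layer a _ ha hH _).1, fun _ => (cakeB_summable_abs_layer a _ ha hH _).2⟩
  have habs_slice : ∀ m' : ℤ, Summable fun ij : ℤ × ℤ => |F (m', ij)| := fun m' =>
    ((Equiv.subRight ((i, j) : ℤ × ℤ)).summable_iff.2 (hslice m').1).congr fun ij => by
      rw [Function.comp_apply, hFg]
  have habs_tsum : ∀ m' : ℤ, ∑' ij : ℤ × ℤ, |F (m', ij)| = ∑' ij : ℤ × ℤ, |g m' ij| := fun m' => by
    simp only [hFg]
    exact Equiv.tsum_eq (Equiv.subRight ((i, j) : ℤ × ℤ)) (fun ij => |g m' ij|)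
  -- absolute summability on `ℤ × ℤ × ℤ`
  have hFabs : Summable fun t : ℤ × ℤ × ℤ => |F t| := by
    rw [summable_prod_of_nonneg fun _ => abs_nonneg _]
    refine ⟨habs_slice, cakeB_summable_of_layer_bound a ha0 z hz m _ fun m' hm => ?_⟩
    rw [abs_of_nonneg (tsum_nonneg fun _ => abs_nonneg _), habs_tsum]
    exact (hslice m').2 hm
  have hFsum : Summable F := hFabs.of_abs
  -- inner sums
  have hinner : ∀ m' : ℤ, ∑' ij : ℤ × ℤ, F (m', ij) =
      layerInteraction lennardJones a (z m' - z m) (haggLabel s m' - haggLabel s m) 1 := by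
    intro m'
    unfold layerInteraction
    simp only [hFg]
    exact Equiv.tsum_eq (Equiv.subRight ((i, j) : ℤ × ℤ)) (g m')
  have hself : layerInteraction lennardJones a (z m - z m) (haggLabel s m - haggLabel s m) 1 =
      inLayerInteraction lennardJones a := by
    rw [sub_self, sub_self, cake_layerInteraction_self]
  have h0 : lennardJones (dist (e (m, i, j)) (e (m, i, j))) = 0 := by rw [dist_self, lennardJones_zero]
  -- assemble
  rw [hS, hpt]
  calc ∑' q : {q : (EuclideanSpace ℝ (Fin 3)) // q ∈ Set.range e ∧ q ≠ e (m, i, j)}, lennardJones (dist (e (m, i,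
      j)) (q : (EuclideanSpace ℝ (Fin 3))))
      = ∑' q : Set.range e, lennardJones (dist (e (m, i, j)) (q : (EuclideanSpace ℝ (Fin 3)))) :=
        cake_tsum_subtype_ne_eq (fun q => lennardJones (dist (e (m, i, j)) q)) _ _ h0
    _ = ∑' t : ℤ × ℤ × ℤ, lennardJones (dist (e (m, i, j)) (e t)) :=
        tsum_range (fun q => lennardJones (dist (e (m, i, j)) q)) hinj
    _ = ∑' t : ℤ × ℤ × ℤ, F t := tsum_congr hfe
    _ = ∑' (m' : ℤ) (ij : ℤ × ℤ), F (m', ij) := hFsum.tsum_prod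
    _ = ∑' m' : ℤ, layerInteraction lennardJones a (z m' - z m) (haggLabel s m' - haggLabel s m) 1 :=
        tsum_congr hinner
    _ = _ := cake_tsum_eq_add_tsum_ite _ m _ hself (cakeB_summable_layers a ha s z hz m)

/-! ## Far indices are far points -/

/-- **Far indices are far points, on the band.** For `a ≥ 9/10`, heights with increments `≥ 7a/10`, letters
`r, r' ∈ {0, 1, 2}` and integer in-plane coordinates: if the layer indices differ by `≥ d + 1`, or one of the two
in-plane index differences is `≥ d + 1` in absolute value, then the two re-centred points are `≥ (d - 1)/4` apart.
[folklore] -/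
theorem cakeB_dist_recentred_ge (a : ℝ) (ha : 9 / 10 ≤ a) (z : ℤ → ℝ)
    (hz : ∀ m : ℤ, 7 / 10 * a ≤ z (m + 1) - z m) {r r' : ℤ} (hr : 0 ≤ r) (hr3 : r < 3)
    (hr' : 0 ≤ r') (hr'3 : r' < 3) (m m' x y x' y' : ℤ) (d : ℕ)
    (hcase : (d : ℤ) + 1 ≤ |m' - m| ∨ (d : ℤ) + 1 ≤ |x' - x| ∨ (d : ℤ) + 1 ≤ |y' - y|) :
    ((d : ℝ) - 1) / 4 ≤ ‖layerVec a (z m' - z m) (r' - r) 1 (x' - x) (y' - y)‖ := by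
  set N := ‖layerVec a (z m' - z m) (r' - r) 1 (x' - x) (y' - y)‖ with hN
  have ha0 : 0 ≤ a := by linarith
  obtain ⟨Δx, hΔx⟩ : ∃ Δx : ℝ, Δx = ((x' - x : ℤ) : ℝ) := ⟨_, rfl⟩
  obtain ⟨Δy, hΔy⟩ : ∃ Δy : ℝ, Δy = ((y' - y : ℤ) : ℝ) := ⟨_, rfl⟩
  obtain ⟨Δr, hΔr⟩ : ∃ Δr : ℝ, Δr = ((r' - r : ℤ) : ℝ) := ⟨_, rfl⟩
  have hΔr2 : |Δr| ≤ 2 := by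
    have h1 : (r' - r : ℤ) ≤ 2 := by omega
    have h2 : (-2 : ℤ) ≤ r' - r := by omega
    rw [hΔr, abs_le]
    exact ⟨by exact_mod_cast h2, by exact_mod_cast h1⟩
  -- coordinate lower bounds
  have hT : a / 2 * |2 * Δx + Δy + Δr| ≤ N := by
    have h := cake_abs_fst_le_norm a (z m' - z m) (r' - r) (x' - x) (y' - y)
    have e : a * (((x' - x : ℤ) : ℝ) + ((y' - y : ℤ) : ℝ) / 2 + ((r' - r : ℤ) : ℝ) / 2) =
        a / 2 * (2 * Δx + Δy + Δr) := by rw [hΔx, hΔy, hΔr]; ring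
    rwa [e, abs_mul, abs_of_nonneg (by positivity : (0 : ℝ) ≤ a / 2)] at h
  have hU : a * √3 / 6 * |3 * Δy + Δr| ≤ N := by
    have h := cake_abs_snd_le_norm a (z m' - z m) (r' - r) (x' - x) (y' - y)
    have e : a * √3 / 2 * (((y' - y : ℤ) : ℝ) + ((r' - r : ℤ) : ℝ) / 3) =
        a * √3 / 6 * (3 * Δy + Δr) := by rw [hΔy, hΔr]; ring
    rwa [e, abs_mul, abs_of_nonneg (by positivity : (0 : ℝ) ≤ a * √3 / 6)] at h
  have hZ : |z m' - z m| ≤ N := cake_abs_height_le_norm a (z m' - z m) (r' - r) (x' - x) (y' - y)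
  -- numerical constants
  have h3 : (17 / 10 : ℝ) ≤ √3 := Real.le_sqrt_of_sq_le (by norm_num)
  have hκ1 : (9 / 20 : ℝ) ≤ a / 2 := by linarith
  have hκ2 : (153 / 600 : ℝ) ≤ a * √3 / 6 := by nlinarith
  have hκ3 : (63 / 100 : ℝ) ≤ 7 / 10 * a := by linarith
  -- triangle inequalities
  have hTx : 2 * |Δx| ≤ |2 * Δx + Δy + Δr| + |Δy| + |Δr| := by
    have e : 2 * Δx = (2 * Δx + Δy + Δr) + (-Δy) + (-Δr) := by ring
    calc 2 * |Δx| = |2 * Δx| := by rw [abs_mul, abs_two]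
      _ = |(2 * Δx + Δy + Δr) + (-Δy) + (-Δr)| := by rw [← e]
      _ ≤ |2 * Δx + Δy + Δr| + |-Δy| + |-Δr| := abs_add_three _ _ _
      _ = _ := by rw [abs_neg, abs_neg]
  have hUy : 3 * |Δy| ≤ |3 * Δy + Δr| + |Δr| := by
    have e : 3 * Δy = (3 * Δy + Δr) + (-Δr) := by ring
    calc 3 * |Δy| = |3 * Δy| := by rw [abs_mul]; norm_num
      _ = |(3 * Δy + Δr) + (-Δr)| := by rw [← e]
      _ ≤ |3 * Δy + Δr| + |-Δr| := abs_add_le _ _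
      _ = _ := by rw [abs_neg]
  rcases hcase with h | h | h
  · -- far layers: vertical distance
    have h' : (d : ℝ) + 1 ≤ |((m' : ℝ) - m)| := by exact_mod_cast h
    have h1 := cakeB_abs_height_diff_ge a ha0 z hz m m'
    have h2 : 63 / 100 * |((m' : ℝ) - m)| ≤ 7 / 10 * a * |((m' : ℝ) - m)| :=
      mul_le_mul_of_nonneg_right hκ3 (abs_nonneg _)
    linarith
  · -- far first index
    have h' : (d : ℝ) + 1 ≤ |Δx| := by rw [hΔx]; exact_mod_cast h
    by_cases hxy : |Δx| ≤ 2 * |Δy|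
    · have h2 : 153 / 600 * |3 * Δy + Δr| ≤ a * √3 / 6 * |3 * Δy + Δr| :=
        mul_le_mul_of_nonneg_right hκ2 (abs_nonneg _)
      linarith
    · push Not at hxy
      have h2 : 9 / 20 * |2 * Δx + Δy + Δr| ≤ a / 2 * |2 * Δx + Δy + Δr| :=
        mul_le_mul_of_nonneg_right hκ1 (abs_nonneg _)
      linarith
  · -- far second index
    have h' : (d : ℝ) + 1 ≤ |Δy| := by rw [hΔy]; exact_mod_cast h
    have h2 : 153 / 600 * |3 * Δy + Δr| ≤ a * √3 / 6 * |3 * Δy + Δr| :=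
      mul_le_mul_of_nonneg_right hκ2 (abs_nonneg _)
    linarith

end Summit.AtomisticToContinuum.Crystallization.Theorems.CleanHull
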